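/-
Copyright (c) 2026 the pub-hodgecm-mathlib formalisation cell (harness21).  Prover seat hodgecm-mathlib-K2E3-p21 (g5), Track B «K2-LIT» ∕ h413
(`stmt-HodgeConjecture-24833`), line `K2_E3_EllipticInputs`, unit U12 §L, road «GL-[M6]-sc» (line lead K2E3-p23 (g5), (M16-2)); brick T20-GL₃ (C-shell B), FILE 5:
«THE BINDER `hcanc` OF ★ ASM-core `nonEllEstimates_of_radius`, PACKAGED HAAR-A.E. ON `G' = GL₃(F) ⧸ ϖ^ℤ·1` OFF THE ELLIPTIC SET» — binder-compatible with ★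
`ae_setIntegral_norm_conj_le_weight` (K2E3-p23 (g5), the `hball` twin).  2026-09-04.
-/
import Summits.HodgeConjecture.HodgeConjecture.Theorems.K2E3GL3SupercuspOrbitalSliceCancellationNormalForm  -- ★ (C-shell B) FILE 4 (this seat): `hcanc` at an integral representative
import Summits.HodgeConjecture.HodgeConjecture.Theorems.K2E3GL3ModUniformizerNonEllBall                     -- ★ ASM-1c (K2E3-p23 g5): rescaling ∕ depth bookkeeping; brings ★ SeparableAE
import HarnessLib

/-!
# K2_E3 road (h413), T20-GL₃ (C-shell B, file 5): `hcanc` Haar-a.e. on `G'`, off the elliptic set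

Cell `pub/hodgecm-mathlib` (D-0151), Track B, seat K2E3-p21 (g5).  CONSUMER: ASM-2 (K2E3-p23 (g5)) — the binder
`hcanc : ∀ n, ∀ᵐ g ∂μ', ¬ E g → ∫ x in Ω n, θ (x * g * x⁻¹) ∂μ' = ∫ x in Ω n ∩ Ω (R g), θ (x * g * x⁻¹) ∂μ'` of ★ `K2E3NonEllEstimatesOfRadius.nonEllEstimates_of_radius`
with `E g := IsCompact (centralizer {g})`, `θ := B u' (ρ · u)` and ANY radius function `R ≥ 150·(s₀ + 7·hgt + L + 1)` (`hgt`, `δ`, `L` exactly the height ∕ normalised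
discriminant ∕ depth functions of ★ `ae_setIntegral_norm_conj_le_weight`).  `--supports stmt-HodgeConjecture-24833 --as helper`; THEOREMS ONLY.

* §1 **`ae_exists_integral_normalForm`** — for `μ'`-a.e. `x̄` with non-compact centralizer there is an INTEGRAL representative `g₁` (`mk g₁ = x̄`) in split or mixed normal
  form with `ϖ^{hgt x̄} g₁⁻¹` integral and `|disc χ_{g₁}| = q^{−L₀}`, `L₀ ≤ L x̄ + 6·hgt x̄` (★ `ae_exists_mk_eq_discr_ne_zero` ∘ ★ (N0) `normalForm_of_discr_ne_zero` ∘ ★ B4-0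
  `exists_zpow_scalar_mul_integral_of_adBall` ∘ ★ `normalForm_smul` ∘ ★ `le_add_of_pow_eq_of_pow_mul_pow_le` — K2E3-p23 (g5)'s route for `hball`, factored as a lemma).
* §2 **`ae_setIntegral_conj_eq_setIntegral_inter`** — `hcanc` packaged: `∃ s₀, ∀ hgt δ L R, … → (∀ x̄, 150·(s₀ + 7·hgt x̄ + L x̄ + 1) ≤ R x̄) → ∀ n, ∀ᵐ x̄, ¬ IsCompact C(x̄) →
  ∫_{Ω n} θ(z̄ x̄ z̄⁻¹) = ∫_{Ω n ∩ Ω (R x̄)} θ(z̄ x̄ z̄⁻¹)` (★ FILE 4 at the representative of §1).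
[HarishChandra1970, Part VII §2 Thm 20 p. 70, §3 pp. 71–73 (`Ω(γ)`)]; [Casselman1995, Thm. 5.3.1].

HONEST LABEL: HC_CM is proved only modulo the 7 printed citations (2 remaining named inputs: hLiu418 = `stmt-HodgeConjecture-24832`, h413 = `stmt-HodgeConjecture-24833`)
until rung 0 closes; this file is a count-neutral helper and closes no socket.

## References
* [HarishChandra1970] Harish-Chandra (notes by G. van Dijk), *Harmonic Analysis on Reductive p-adic Groups*, LNM 162 (1970), Part VII §2 Thm 18–20 pp. 69–70, §3 pp. 71–73.
* [Casselman1995] W. Casselman, *Introduction to the theory of admissible representations of `p`-adic reductive groups* (1995 notes), Thm. 5.3.1.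
-/

set_option autoImplicit false
-- the mandated namespace repeats the single-problem summit's segment (`HodgeConjecture.HodgeConjecture`)
set_option linter.dupNamespace false

noncomputable section

open MeasureTheory MeasureTheory.Measure Set Filter Topology
open scoped MatrixGroups Pointwise WithZero NNReal ENNReal
open Literature.NumberTheory.Automorphic Literature.NumberTheory.GaloisRepresentations Literature.NumberTheory.GaloisRepresentations.IsNonarchimedeanLocalField
open Summit.HodgeConjecture.HodgeConjecture.Cruxes.H413.K2E3GLnAdHeightBalls
open Summit.HodgeConjecture.HodgeConjecture.Cruxes.H413.K2E3GL3TruncatedCharMixedTorusRadius (v_pow_pow_three_le_v_det)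
open Summit.HodgeConjecture.HodgeConjecture.Cruxes.H413.K2E3GL3ModUniformizerNonEllBallMixed (normAbs_uniformizer_eq_inv)
open Summit.HodgeConjecture.HodgeConjecture.Cruxes.H413.K2E3GL3ModUniformizerNonEllBall
open Summit.HodgeConjecture.HodgeConjecture.Cruxes.H413.K2E3GL3ModUniformizerFundamentalDomain (mk_scalar_zpow_mul)
open Summit.HodgeConjecture.HodgeConjecture.Cruxes.H413.K2E3GL3ModUniformizerSeparableAE (ae_exists_mk_eq_discr_ne_zero)
open Summit.HodgeConjecture.HodgeConjecture.Cruxes.H413.K2E3GL3ModUniformizerCentralizerCompact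
open Summit.HodgeConjecture.HodgeConjecture.Cruxes.H413.K2E3GL3CharpolyDiscNullHaar (normalForm_of_discr_ne_zero)
open Summit.HodgeConjecture.HodgeConjecture.Cruxes.H413.K2E3GL3SupercuspOrbitalSliceCancellationNormalForm

namespace Summit.HodgeConjecture.HodgeConjecture.Cruxes.H413.K2E3GL3SupercuspOrbitalSliceCancellationAE

variable {F : Type*} [Field F] [Valued F ℤᵐ⁰] [ValuativeRel F] [(Valued.v : Valuation F ℤᵐ⁰).Compatible] [IsNonarchimedeanLocalField F] [CharZero F]
  [MeasurableSpace F] [BorelSpace F] [MeasurableSpace (GL (Fin 3) F)] [BorelSpace (GL (Fin 3) F)]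
  {ϖ : F} (hϖ : Valued.v ϖ = WithZero.exp (-1 : ℤ)) (hϖ0 : ϖ ≠ 0)
  [((Subgroup.zpowers (Units.mk0 ϖ hϖ0)).map (Matrix.GeneralLinearGroup.scalar (Fin 3))).Normal]
  [MeasurableSpace (GL (Fin 3) F ⧸ (Subgroup.zpowers (Units.mk0 ϖ hϖ0)).map (Matrix.GeneralLinearGroup.scalar (Fin 3)))]
  [BorelSpace (GL (Fin 3) F ⧸ (Subgroup.zpowers (Units.mk0 ϖ hϖ0)).map (Matrix.GeneralLinearGroup.scalar (Fin 3)))]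
  {V : Type*} [AddCommGroup V] [Module ℂ V] (ρ : Representation ℂ (GL (Fin 3) F ⧸ (Subgroup.zpowers (Units.mk0 ϖ hϖ0)).map (Matrix.GeneralLinearGroup.scalar (Fin 3))) V)
  (hρ : ρ.IsSmooth) (hsc : ρ.IsSupercuspidal) {B : V →ₗ⋆[ℂ] V →ₗ[ℂ] ℂ}
  (hBinv : ∀ (g : GL (Fin 3) F ⧸ (Subgroup.zpowers (Units.mk0 ϖ hϖ0)).map (Matrix.GeneralLinearGroup.scalar (Fin 3))) (v w : V), B (ρ g v) (ρ g w) = B v w) (u u' : V)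
  (Ω : CompactExhaustion (GL (Fin 3) F ⧸ (Subgroup.zpowers (Units.mk0 ϖ hϖ0)).map (Matrix.GeneralLinearGroup.scalar (Fin 3))))
  (hmem : ∀ (m : ℕ) (g : GL (Fin 3) F),
    (QuotientGroup.mk g : GL (Fin 3) F ⧸ (Subgroup.zpowers (Units.mk0 ϖ hϖ0)).map (Matrix.GeneralLinearGroup.scalar (Fin 3))) ∈ Ω m ↔
      ∀ i j k l, Valued.v (ϖ ^ m * ((g : Matrix (Fin 3) (Fin 3) F) i j * ((g⁻¹ : GL (Fin 3) F) : Matrix (Fin 3) (Fin 3) F) k l)) ≤ 1)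
  (hK : ∀ (m : ℕ) (k : GL (Fin 3) F), k ∈ glInt 3 F → ∀ x : GL (Fin 3) F ⧸ (Subgroup.zpowers (Units.mk0 ϖ hϖ0)).map (Matrix.GeneralLinearGroup.scalar (Fin 3)),
    ((QuotientGroup.mk k : GL (Fin 3) F ⧸ _) * x ∈ Ω m ↔ x ∈ Ω m) ∧ (x * (QuotientGroup.mk k : GL (Fin 3) F ⧸ _) ∈ Ω m ↔ x ∈ Ω m))
  (μ' : Measure (GL (Fin 3) F ⧸ (Subgroup.zpowers (Units.mk0 ϖ hϖ0)).map (Matrix.GeneralLinearGroup.scalar (Fin 3)))) [μ'.IsHaarMeasure]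

/-! ## §1  A.e. off the elliptic set: an integral representative in normal form, with controlled depth -/

omit [CharZero F] [MeasurableSpace F] [BorelSpace F] [MeasurableSpace (GL (Fin 3) F)] [BorelSpace (GL (Fin 3) F)] in
include hϖ hmem in
/-- **A.E. INTEGRAL REPRESENTATIVE IN NORMAL FORM** (K2E3-p23 (g5)'s route for `hball`, as a lemma): for `μ'`-a.e. `x̄ ∈ G'` whose centralizer is NOT compact there are `g₁` with
`mk g₁ = x̄` and `L₀` such that `g₁` is in split (`y·diag d·y⁻¹`, `d` injective) or mixed (`y·[[e₀,e₁,0],[e₂,e₃,0],[0,0,e₄]]·y⁻¹`, block `χ` irreducible) normal form, `g₁` is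
INTEGRAL, `ϖ^{hgt x̄} g₁⁻¹` is integral, `|disc χ_{g₁}| = q^{−L₀}` and `L₀ ≤ L x̄ + 6·hgt x̄` — for any height function `hgt` (`x̄ ∈ Ω (hgt x̄)`), normalised discriminant `δ`
(`δ(mk g) = ‖disc χ_g‖ ∕ ‖det g‖²`) and depth `L` (`q^{−L x̄} ≤ δ x̄` when `δ x̄ ≠ 0`). [cite: HarishChandra1970, Part VII §2 p. 69, §3 pp. 72–73] -/
theorem ae_exists_integral_normalForm
    (hgt : GL (Fin 3) F ⧸ (Subgroup.zpowers (Units.mk0 ϖ hϖ0)).map (Matrix.GeneralLinearGroup.scalar (Fin 3)) → ℕ)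
    (δ : GL (Fin 3) F ⧸ (Subgroup.zpowers (Units.mk0 ϖ hϖ0)).map (Matrix.GeneralLinearGroup.scalar (Fin 3)) → ℝ≥0)
    (L : GL (Fin 3) F ⧸ (Subgroup.zpowers (Units.mk0 ϖ hϖ0)).map (Matrix.GeneralLinearGroup.scalar (Fin 3)) → ℕ)
    (hhgt : ∀ x, x ∈ Ω (hgt x))
    (hδ : ∀ g : GL (Fin 3) F, δ (QuotientGroup.mk g) =
      normAbs F ((g : Matrix (Fin 3) (Fin 3) F)).charpoly.discr / normAbs F ((g : Matrix (Fin 3) (Fin 3) F)).det ^ 2)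
    (hL : ∀ x, δ x ≠ 0 → ((residueFieldCard F : ℝ≥0)⁻¹) ^ (L x) ≤ δ x) :
    ∀ᵐ x ∂μ', ¬ IsCompact ((Subgroup.centralizer {x} :
          Subgroup (GL (Fin 3) F ⧸ (Subgroup.zpowers (Units.mk0 ϖ hϖ0)).map (Matrix.GeneralLinearGroup.scalar (Fin 3)))) :
        Set (GL (Fin 3) F ⧸ (Subgroup.zpowers (Units.mk0 ϖ hϖ0)).map (Matrix.GeneralLinearGroup.scalar (Fin 3)))) →
      ∃ (g₁ : GL (Fin 3) F) (L₀ : ℕ),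
        (QuotientGroup.mk g₁ : GL (Fin 3) F ⧸ (Subgroup.zpowers (Units.mk0 ϖ hϖ0)).map (Matrix.GeneralLinearGroup.scalar (Fin 3))) = x ∧
        ((∃ (y : GL (Fin 3) F) (d : Fin 3 → F), Function.Injective d ∧
            (g₁ : Matrix (Fin 3) (Fin 3) F) = (y : Matrix (Fin 3) (Fin 3) F) * Matrix.diagonal d * ((y⁻¹ : GL (Fin 3) F) : Matrix (Fin 3) (Fin 3) F)) ∨
          (∃ (y : GL (Fin 3) F) (e : Fin 5 → F), Irreducible ((!![e 0, e 1; e 2, e 3] : Matrix (Fin 2) (Fin 2) F)).charpoly ∧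
            (g₁ : Matrix (Fin 3) (Fin 3) F) =
              (y : Matrix (Fin 3) (Fin 3) F) * !![e 0, e 1, 0; e 2, e 3, 0; 0, 0, e 4] * ((y⁻¹ : GL (Fin 3) F) : Matrix (Fin 3) (Fin 3) F))) ∧
        (∀ i j, Valued.v ((g₁ : Matrix (Fin 3) (Fin 3) F) i j) ≤ 1) ∧
        (∀ i j, Valued.v (ϖ ^ hgt x * ((g₁⁻¹ : GL (Fin 3) F) : Matrix (Fin 3) (Fin 3) F) i j) ≤ 1) ∧
        Valued.v ((g₁ : Matrix (Fin 3) (Fin 3) F)).charpoly.discr = WithZero.exp (-(L₀ : ℤ)) ∧ L₀ ≤ L x + 6 * hgt x := by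
  filter_upwards [ae_exists_mk_eq_discr_ne_zero hϖ hϖ0 μ'] with x hx hnc
  obtain ⟨g, rfl, hD⟩ := hx
  -- the height and the integral representative `g₁ = ϖ^k g`
  set h : ℕ := hgt (QuotientGroup.mk g) with hhdef
  have hball : ∀ i j k l, Valued.v (ϖ ^ h * ((g : Matrix (Fin 3) (Fin 3) F) i j * ((g⁻¹ : GL (Fin 3) F) : Matrix (Fin 3) (Fin 3) F) k l)) ≤ 1 :=
    (hmem h g).1 (hhgt _)
  obtain ⟨k, hint, hinv⟩ := exists_zpow_scalar_mul_integral_of_adBall hϖ hϖ0 hball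
  set g₁ : GL (Fin 3) F := Matrix.GeneralLinearGroup.scalar (Fin 3) (Units.mk0 ϖ hϖ0 ^ k) * g with hg₁def
  have hmk : (QuotientGroup.mk g₁ : GL (Fin 3) F ⧸ (Subgroup.zpowers (Units.mk0 ϖ hϖ0)).map (Matrix.GeneralLinearGroup.scalar (Fin 3))) =
      QuotientGroup.mk g := mk_scalar_zpow_mul hϖ0 k g
  have hu : ((Units.mk0 ϖ hϖ0 ^ k : Fˣ) : F) ≠ 0 := (Units.mk0 ϖ hϖ0 ^ k).ne_zero
  have hcoe : (g₁ : Matrix (Fin 3) (Fin 3) F) = ((Units.mk0 ϖ hϖ0 ^ k : Fˣ) : F) • (g : Matrix (Fin 3) (Fin 3) F) := coe_scalar_mul _ _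
  -- normal form of `g` (off the elliptic set) and of `g₁`
  have hnf₁ : (∃ (y : GL (Fin 3) F) (d : Fin 3 → F), Function.Injective d ∧
        (g₁ : Matrix (Fin 3) (Fin 3) F) = (y : Matrix (Fin 3) (Fin 3) F) * Matrix.diagonal d * ((y⁻¹ : GL (Fin 3) F) : Matrix (Fin 3) (Fin 3) F)) ∨
      (∃ (y : GL (Fin 3) F) (m : Fin 5 → F), Irreducible ((!![m 0, m 1; m 2, m 3] : Matrix (Fin 2) (Fin 2) F)).charpoly ∧
        (g₁ : Matrix (Fin 3) (Fin 3) F) =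
          (y : Matrix (Fin 3) (Fin 3) F) * !![m 0, m 1, 0; m 2, m 3, 0; 0, 0, m 4] * ((y⁻¹ : GL (Fin 3) F) : Matrix (Fin 3) (Fin 3) F)) := by
    rw [hcoe]
    refine normalForm_smul hu ?_
    rcases normalForm_of_discr_ne_zero _ hD with h' | h' | h'
    · exact Or.inl h'
    · exact Or.inr h'
    · exact absurd (isCompact_centralizer_mk_of_irreducible hϖ hϖ0 g h') hnc
  -- `δ x̄ = ‖disc χ_{g₁}‖ ∕ ‖det g₁‖²`, nonzero
  have hdet0 : ((g₁ : Matrix (Fin 3) (Fin 3) F)).det ≠ 0 := ((Matrix.isUnit_iff_isUnit_det _).1 (Units.isUnit g₁)).ne_zero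
  have hdetg0 : ((g : Matrix (Fin 3) (Fin 3) F)).det ≠ 0 := ((Matrix.isUnit_iff_isUnit_det _).1 (Units.isUnit g)).ne_zero
  have hδx : δ (QuotientGroup.mk g) = normAbs F ((g₁ : Matrix (Fin 3) (Fin 3) F)).charpoly.discr / normAbs F ((g₁ : Matrix (Fin 3) (Fin 3) F)).det ^ 2 := by
    rw [← hmk]; exact hδ g₁
  have hδ0 : δ (QuotientGroup.mk g) ≠ 0 := by
    rw [hδ g]
    exact div_ne_zero ((_root_.map_ne_zero _).2 hD) (pow_ne_zero _ ((_root_.map_ne_zero _).2 hdetg0))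
  have ha0 : normAbs F ((g₁ : Matrix (Fin 3) (Fin 3) F)).det ≠ 0 := (_root_.map_ne_zero _).2 hdet0
  have hDeq : normAbs F ((g₁ : Matrix (Fin 3) (Fin 3) F)).charpoly.discr = δ (QuotientGroup.mk g) * normAbs F ((g₁ : Matrix (Fin 3) (Fin 3) F)).det ^ 2 := by
    rw [hδx, div_mul_cancel₀ _ (pow_ne_zero _ ha0)]
  have hdisc0 : ((g₁ : Matrix (Fin 3) (Fin 3) F)).charpoly.discr ≠ 0 := by
    intro h0; apply hδ0; rw [hδx, h0, map_zero, zero_div]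
  -- the depth exponent `L₀` of the representative and `L₀ ≤ L x̄ + 6 h`
  obtain ⟨L₀, hL₀⟩ := exists_nat_v_eq_exp_neg hdisc0 (v_discr_charpoly_le_one_of_normalForm hnf₁ hint)
  have hq : normAbs F ϖ = (residueFieldCard F : ℝ≥0)⁻¹ := normAbs_uniformizer_eq_inv hϖ
  have hs0 : (0 : ℝ≥0) < (residueFieldCard F : ℝ≥0)⁻¹ := inv_residueFieldCard_pos
  have hs1 : (residueFieldCard F : ℝ≥0)⁻¹ < 1 := inv_residueFieldCard_lt_one
  have hdet : ((residueFieldCard F : ℝ≥0)⁻¹) ^ (3 * h) ≤ normAbs F ((g₁ : Matrix (Fin 3) (Fin 3) F)).det := by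
    have hv := v_pow_pow_three_le_v_det (y := g₁) hinv
    have hn : normAbs F ((ϖ ^ h) ^ 3) ≤ normAbs F ((g₁ : Matrix (Fin 3) (Fin 3) F)).det :=
      normAbs_le_normAbs_iff.2 ((v_le_iff_valuation_le _ _).1 hv)
    rwa [map_pow, map_pow, hq, ← pow_mul, mul_comm] at hn
  have hDL : ((residueFieldCard F : ℝ≥0)⁻¹) ^ L₀ = normAbs F ((g₁ : Matrix (Fin 3) (Fin 3) F)).charpoly.discr := by
    have hϖL : Valued.v (ϖ ^ L₀) = WithZero.exp (-(L₀ : ℤ)) := by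
      rw [map_pow, hϖ, ← WithZero.exp_nsmul]; congr 1; simp
    have hv : Valued.v ((g₁ : Matrix (Fin 3) (Fin 3) F)).charpoly.discr = Valued.v (ϖ ^ L₀) := by rw [hL₀, hϖL]
    have h1 := normAbs_le_normAbs_iff.2 ((v_le_iff_valuation_le _ _).1 hv.le)
    have h2' := normAbs_le_normAbs_iff.2 ((v_le_iff_valuation_le _ _).1 hv.ge)
    rw [map_pow, hq] at h1 h2'
    exact le_antisymm h2' h1
  have hLle : L₀ ≤ L (QuotientGroup.mk g) + 2 * (3 * h) :=
    le_add_of_pow_eq_of_pow_mul_pow_le hs0 hs1 (hDL.trans hDeq) (hL _ hδ0) hdet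
  exact ⟨g₁, L₀, hmk, hnf₁, hint, hinv, hL₀, by omega⟩

/-! ## §2  `hcanc`, packaged -/

include hϖ hρ hsc hBinv hmem hK in
/-- **`hcanc` PACKAGED (Haar-a.e. on `G'`, off the elliptic set)** — the binder of ★ `nonEllEstimates_of_radius` for `θ = B u' (ρ · u)`, `E x̄ := IsCompact C(x̄)`: there is a support height
`s₀` such that for every height `hgt` (`x̄ ∈ Ω (hgt x̄)`), every `δ` with `δ(mk g) = ‖disc χ_g‖ ∕ ‖det g‖²`, every depth `L` (`q^{−L x̄} ≤ δ x̄` where `δ x̄ ≠ 0`) and every radius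
function `R` with `150·(s₀ + 7·hgt x̄ + L x̄ + 1) ≤ R x̄`: for every `n`, for `μ'`-a.e. `x̄` with NON-compact centralizer,
**`∫_{Ω n} θ(z̄ x̄ z̄⁻¹) dμ'(z̄) = ∫_{Ω n ∩ Ω (R x̄)} θ(z̄ x̄ z̄⁻¹) dμ'(z̄)`** (★ FILE 4 at the representative of §1). [cite: HarishChandra1970, Part VII §2 Thm 20 p. 70, §3 pp. 71–73]
[cite: Casselman1995, Thm. 5.3.1] -/
theorem ae_setIntegral_conj_eq_setIntegral_inter :
    ∃ s₀ : ℕ, ∀ (hgt : GL (Fin 3) F ⧸ (Subgroup.zpowers (Units.mk0 ϖ hϖ0)).map (Matrix.GeneralLinearGroup.scalar (Fin 3)) → ℕ)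
        (δ : GL (Fin 3) F ⧸ (Subgroup.zpowers (Units.mk0 ϖ hϖ0)).map (Matrix.GeneralLinearGroup.scalar (Fin 3)) → ℝ≥0)
        (L R : GL (Fin 3) F ⧸ (Subgroup.zpowers (Units.mk0 ϖ hϖ0)).map (Matrix.GeneralLinearGroup.scalar (Fin 3)) → ℕ),
      (∀ x, x ∈ Ω (hgt x)) →
      (∀ g : GL (Fin 3) F, δ (QuotientGroup.mk g) =
          normAbs F ((g : Matrix (Fin 3) (Fin 3) F)).charpoly.discr / normAbs F ((g : Matrix (Fin 3) (Fin 3) F)).det ^ 2) →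
      (∀ x, δ x ≠ 0 → ((residueFieldCard F : ℝ≥0)⁻¹) ^ (L x) ≤ δ x) →
      (∀ x, 150 * (s₀ + 7 * hgt x + L x + 1) ≤ R x) →
      ∀ n : ℕ, ∀ᵐ x ∂μ', ¬ IsCompact ((Subgroup.centralizer {x} :
            Subgroup (GL (Fin 3) F ⧸ (Subgroup.zpowers (Units.mk0 ϖ hϖ0)).map (Matrix.GeneralLinearGroup.scalar (Fin 3)))) :
          Set (GL (Fin 3) F ⧸ (Subgroup.zpowers (Units.mk0 ϖ hϖ0)).map (Matrix.GeneralLinearGroup.scalar (Fin 3)))) →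
        ∫ z in Ω n, B u' (ρ (z * x * z⁻¹) u) ∂μ' = ∫ z in Ω n ∩ Ω (R x), B u' (ρ (z * x * z⁻¹) u) ∂μ' := by
  obtain ⟨s₀, hs₀⟩ := exists_radius_setIntegral_conj_eq_setIntegral_inter_of_integral_normalForm hϖ hϖ0 ρ hρ hsc hBinv u u' Ω hmem hK μ'
  refine ⟨s₀, fun hgt δ L R hhgt hδ hL hR n => ?_⟩
  filter_upwards [ae_exists_integral_normalForm hϖ hϖ0 Ω hmem μ' hgt δ L hhgt hδ hL] with x hx hnc
  obtain ⟨g₁, L₀, hmk, hnf, hint, hinv, hL₀, hLle⟩ := hx hnc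
  have key := hs₀ g₁ (hgt x) L₀ hnf hint hinv hL₀ n (R x) ((by have := hR x; omega))
  rwa [hmk] at key

end Summit.HodgeConjecture.HodgeConjecture.Cruxes.H413.K2E3GL3SupercuspOrbitalSliceCancellationAE

end
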